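import Summits.QuantumFields.YangMills.Theorems.UnitScaleTiltProp7CornerCombCovGradTransfer
import Summits.QuantumFields.YangMills.Theorems.UnitScaleTiltProp7CellBoxMultiplicity
import HarnessLib

/-!
# Route `UnitScaleTilt`, crux K1 «MinimiserStabilityRegPr» (stmt-QuantumFields-19200), route-R E′ (A′)-on-Σ, P-A2 (β), row «(n3)-comb» —
# (O2) GROUNDWORK, file F-7b-1: THE PER-LEVEL `ℓ²` MASS ROW OF THE SOURCED COMB TOWER OVER A PERIOD CELL (MINKOWSKI) —
# `√Σ_{cell′}‖G̃′‖² ≤ (√(L²L⁻ᵈ) + 210(2d+2)L·α·√(2d))·√Σ_{cell}‖G̃‖² + C·μ·(2d+2)L·√(2d)·√Σ_{cell}‖Ỹ‖²`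

«(O2) groundwork — not consumed by any displayed row before the freeze lifts» (★★OWNER `ym3-torus-plan` g29∕g30 RULINGS №20 (2), №22 (c) «(II) GO»).
Cell `ym3-torus`, D-0154 (3c) R3 twin-width seat `ym-routeR-w4` (gen 16); pen F-7b named by ★routeR-w1 g9 (PENS ROUND 4, 2026-08-29 08:50Z).
THEOREMS ONLY (0 `def`, 0 `sorry`); `--supports stmt-QuantumFields-19200 --as helper`, count-neutral.  YM₃ on T³ is a ladder rung (R3), not the Clay problem; nothing here
claims `hMcomb`, `hMcomb₂`, (β), `hPA2`, `hcoS`, the stub, the crux, d = 4 or the mass gap.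

THE POINT.  One step of the SOURCED reduced comb tower (F-7a) reads, by the split ✓`Prop7CombTrueStepSplit.norm_trueStep_sub_split_le` (F-5a),
`G̃′(z,κ) = L·(Q₀G̃)(L•z,κ) + DEF(L•z,κ) + rem(z,κ)` — print's STRAIGHT step (125), the `210·α·m` defect, and the second-order source.  Over ONE period cell (organisation W1:
level-k fields `N_k = N′·L`-periodic on `ℤᵈ`, level-(k+1) fields `N′`-periodic; cells `{boxVec (N′L) t}` ∕ `{boxVec N′ z}`) the three pieces are bounded in `ℓ²` SEPARATELY and
knitted by Minkowski (§4 ★★★`sqrt_sum_cell_normSq_step_le`, + `_level` at `V = Ū₀ᵏ`):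
* (i) §2 the COVARIANT CELL JENSEN `Σ_z ‖L·(Q₀X)(L•z,κ)‖² ≤ L²L⁻ᵈ·Σ_t ‖X(t,κ)‖²` — as the flat ✓`Prop7CornerCombFlatJensen` (II-2): the transports inside `Q₀` (lit ✓`Q0cov`,
  unfolded by ✓`Prop7CornerCombCovGradTransfer.smul_Q0cov_eq_sum`) are conjugations by `U1` units, isometric (lit ✓`norm_conjR_le`); `Lᵈ·L` bond values of weight `L⁻ᵈ` give
  Jensen's `L·L⁻ᵈ`, and the shifted blocks `L•z + r + t•e_κ`, `t < L`, cover the fine cell exactly `L` times — ✓`Prop7CellBoxMultiplicity.sum_cell_block_seg_eq` (F-6d-1,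
  ★routeR-w6), no fibre counts.  The A-slot contraction is `ρ = √(L²L⁻ᵈ) = L^{(2−d)∕2}` (`L^{−1∕2}` at `d = 3`).
* (ii) the defect — ✓`Prop7CombTrueStepDefectCell.sum_cell_trueStep_defect_sq_le` (F-5c) BY NAME: `Σ‖DEF‖² ≤ (210(2d+2)L)²·α²·2d·Σ‖X‖²`.
* (iii) §3 the source in TWO-BLOCK `ℓ²`, the two-block SUP displayed as a WINDOW LETTER `μ` (shape of ✓`Prop7FibreLevelMass`'s `hμ`): from `‖rem(z,κ)‖ ≤ C·((2d+2)L)²·M₂(L•z,κ)`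
  (✓`Prop7CombWalkMassTwoBlock.norm_rem2_succ_sub_trueStep_le_twoBlock`: `C = 260`, `M₂` the two-block mass of the driving field `Ỹ`) and `(2d+2)L·√M₂ ≤ μ`:
  `Σ_{z,κ}‖rem‖² ≤ (Cμ)²·((2d+2)L)²·2d·Σ_{t,ν}‖Ỹ(t,ν)‖²` (★★`sum_cell_normSq_source_le`) — the two blocks of the `d·N′ᵈ` coarse bonds cover the fine cell `2d` times (§1 ★`sum_cell_twoBlock_eq`).
The scalar induction over levels is F-7c (w5-19200); the gradient companion F-7b-2 is stated for the SOURCELESS family (w5's located `#levels` trap); the torus dictionary is F-8.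
HONEST SCOPE.  Bookkeeping + Jensen + Minkowski over cited tree∕lit theorems; the windows `α ≤ 1∕24`, `μ` are hypotheses (discharged from `RegPr` upstream, not here); `𝔸` any
non-trivial C⋆-algebra, `V` unitary-valued, every `d`, `L ≥ 1`, `N′ ≥ 1`.

References: T. Bałaban, CMP **98** (1985) 17–51 [Balaban1985Averaging] ((2) p.17, (42)–(43) pp.23–24, Prop. 3 (122)–(126) p.36); CMP **95** (1984) 17–40 [Balaban1984PropagatorsI]
((1.18)–(1.20) pp.19–20); CMP **109** (1987) 249–301 [Balaban1987RG1] ((0.1), (0.4) pp.251–253).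
-/

noncomputable section

open scoped BigOperators
open Finset

namespace Summit.QuantumFields.YangMills.Theorems.Prop7CornerCombCovMassStep

open NormedSpace
open Literature.MathematicalPhysics.QuantumFieldTheory.Balaban1983to89
open ExpMeanLog (eml)
open B7Prop1Explicit (Site Letter e hol seg treeWord boxVec gammaWord Wcx Xavg bavg expUnit U1 hol_mem)
open B7Prop2Explicit (avgIter avgIter_succ rescale_apply unitaryUnits unitaryUnits_le_U1)
open B7Eq78Linearization (conjR)
open B7Prop3GeneralRotated (tsum norm_conjR_le)
open B7Prop3GeneralLinear (FhatCov Q0cov)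
open Summit.QuantumFields.YangMills.Theorems.Prop7CornerCombCovGradTransfer (smul_Q0cov_eq_sum)
open Summit.QuantumFields.YangMills.Theorems.Prop7CombTrueStepDefectCell (sum_cell_tiling sum_cell_trueStep_defect_sq_le)
open Summit.QuantumFields.YangMills.Theorems.Prop7CellBoxMultiplicity (sum_cell_block_shift_eq sum_cell_block_seg_eq)

/-! ## §1 The two blocks of the coarse bonds of a period cell cover the fine cell `2d` times -/

section TwoBlock

variable {d : ℕ} {E : Type*} [SeminormedAddCommGroup E]

/-- ★ **THE TWO-BLOCK MASSES OVER THE COARSE CELL**: for an `N′L`-periodic field `Y`, the two-block masses `M₂(L•z,κ) = Σ_{s∈[0,L)ᵈ,ν}(‖Y(L•z+s,ν)‖² + ‖Y(L•z+Le_κ+s,ν)‖²)`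
of the coarse bonds `(z,κ)` of the cell add up to `2d` fine-cell masses: `Σ_{z,κ} M₂(L•z,κ) = 2d·Σ_{t′,ν} ‖Y(t′,ν)‖²` (each fine block is the lower block of `d` bonds and the upper
block of `d` bonds: ✓`sum_cell_tiling` and ✓`Prop7CellBoxMultiplicity.sum_cell_block_shift_eq` at `v = e_κ`). [cite: Balaban1985Averaging, (2) p.17, (42) p.23] -/
theorem sum_cell_twoBlock_eq (L N' : ℕ) (hL : 1 ≤ L) [NeZero N'] (Y : Site d → Fin d → E)
    (hY : ∀ (x : Site d) (κ μ : Fin d), Y (x + ((N' * L : ℕ) : ℤ) • e κ) μ = Y x μ) :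
    ∑ z : Fin d → Fin N', ∑ κ : Fin d, ∑ s : Fin d → Fin L, ∑ ν : Fin d,
        (‖Y ((L : ℤ) • boxVec N' z + boxVec L s) ν‖ ^ 2 + ‖Y ((L : ℤ) • boxVec N' z + (L : ℤ) • e κ + boxVec L s) ν‖ ^ 2)
      = 2 * d * ∑ t' : Fin d → Fin (N' * L), ∑ ν : Fin d, ‖Y (boxVec (N' * L) t') ν‖ ^ 2 := by
  set F : Site d → ℝ := fun y => ∑ ν : Fin d, ‖Y y ν‖ ^ 2 with hF
  have hFper : ∀ (x : Site d) (κ : Fin d), F (x + ((N' * L : ℕ) : ℤ) • e κ) = F x := fun x κ => by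
    simp only [hF, hY]
  -- lower blocks: the tiling
  have hlow : ∑ z : Fin d → Fin N', ∑ s : Fin d → Fin L, F ((L : ℤ) • boxVec N' z + boxVec L s)
      = ∑ t' : Fin d → Fin (N' * L), F (boxVec (N' * L) t') := (sum_cell_tiling N' L hL F).symm
  -- upper blocks: the corners shifted by `e_κ`
  have hup : ∀ κ : Fin d, ∑ z : Fin d → Fin N', ∑ s : Fin d → Fin L, F ((L : ℤ) • boxVec N' z + (L : ℤ) • e κ + boxVec L s)
      = ∑ t' : Fin d → Fin (N' * L), F (boxVec (N' * L) t') := fun κ => by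
    rw [← sum_cell_block_shift_eq N' L hL (N' * L) rfl F hFper (e κ)]
    refine Finset.sum_congr rfl fun z _ => Finset.sum_congr rfl fun s _ => ?_
    rw [smul_add]
  calc ∑ z : Fin d → Fin N', ∑ κ : Fin d, ∑ s : Fin d → Fin L, ∑ ν : Fin d,
          (‖Y ((L : ℤ) • boxVec N' z + boxVec L s) ν‖ ^ 2 + ‖Y ((L : ℤ) • boxVec N' z + (L : ℤ) • e κ + boxVec L s) ν‖ ^ 2)
      = ∑ κ : Fin d, (∑ z : Fin d → Fin N', ∑ s : Fin d → Fin L, F ((L : ℤ) • boxVec N' z + boxVec L s)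
          + ∑ z : Fin d → Fin N', ∑ s : Fin d → Fin L, F ((L : ℤ) • boxVec N' z + (L : ℤ) • e κ + boxVec L s)) := by
        rw [Finset.sum_comm]
        refine Finset.sum_congr rfl fun κ _ => ?_
        rw [← Finset.sum_add_distrib]
        refine Finset.sum_congr rfl fun z _ => ?_
        rw [← Finset.sum_add_distrib]
        refine Finset.sum_congr rfl fun s _ => ?_
        simp only [hF, ← Finset.sum_add_distrib]
    _ = ∑ κ : Fin d, (2 * ∑ t' : Fin d → Fin (N' * L), F (boxVec (N' * L) t')) := by
        refine Finset.sum_congr rfl fun κ _ => ?_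
        rw [hlow, hup κ, two_mul]
    _ = 2 * d * ∑ t' : Fin d → Fin (N' * L), ∑ ν : Fin d, ‖Y (boxVec (N' * L) t') ν‖ ^ 2 := by
        rw [Finset.sum_const, Finset.card_univ, Fintype.card_fin, nsmul_eq_mul]
        ring

end TwoBlock

/-! ## §2 (i) The covariant cell Jensen for print's straight step `L·(Q₀X)` -/

section Jensen

variable {d : ℕ} {𝔸 : Type*} [CStarAlgebra 𝔸] [Nontrivial 𝔸]

/-- **`‖L·(Q₀X)(q,κ)‖ ≤ Σ_{r,t<L} L⁻ᵈ·‖X(q + r + te_κ, κ)‖`** at a unitary-valued `V`: the transports in (125) are isometries (lit ✓`norm_conjR_le`).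
[cite: Balaban1985Averaging, (125) p.36] -/
theorem norm_smul_Q0cov_le (L : ℕ) (hL : 1 ≤ L) (V : Site d → Fin d → 𝔸ˣ) (hV : ∀ x μ, V x μ ∈ unitaryUnits 𝔸)
    (X : Site d → Fin d → 𝔸) (q : Site d) (κ : Fin d) :
    ‖(L : ℝ) • Q0cov L V X q κ‖ ≤ ∑ r : Fin d → Fin L, ∑ t ∈ Finset.range L, ((L : ℝ) ^ d)⁻¹ * ‖X (q + boxVec L r + (t : ℤ) • e κ) κ‖ := by
  have hV' : ∀ x μ, V x μ ∈ U1 𝔸 := fun x μ => unitaryUnits_le_U1 (hV x μ)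
  rw [smul_Q0cov_eq_sum L hL V X q κ]
  refine (norm_sum_le _ _).trans (Finset.sum_le_sum fun r _ => (norm_sum_le _ _).trans (Finset.sum_le_sum fun t _ => ?_))
  rw [norm_smul, Real.norm_of_nonneg (by positivity)]
  exact mul_le_mul_of_nonneg_left (norm_conjR_le (hol_mem hV' _ _) _) (by positivity)

/-- ★ **POINTWISE COVARIANT JENSEN**: `‖L·(Q₀X)(q,κ)‖² ≤ L·L⁻ᵈ·Σ_{r,t<L} ‖X(q + r + te_κ, κ)‖²` — `Lᵈ·L` isometrically transported bond values of weight `L⁻ᵈ`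
(the covariant twin of ✓`Prop7CornerCombFlatJensen.straight_step_normSq_le`). [cite: Balaban1985Averaging, (125) p.36] -/
theorem normSq_smul_Q0cov_le (L : ℕ) (hL : 1 ≤ L) (V : Site d → Fin d → 𝔸ˣ) (hV : ∀ x μ, V x μ ∈ unitaryUnits 𝔸)
    (X : Site d → Fin d → 𝔸) (q : Site d) (κ : Fin d) :
    ‖(L : ℝ) • Q0cov L V X q κ‖ ^ 2
      ≤ (L : ℝ) * ((L : ℝ) ^ d)⁻¹ * ∑ r : Fin d → Fin L, ∑ t ∈ Finset.range L, ‖X (q + boxVec L r + (t : ℤ) • e κ) κ‖ ^ 2 := by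
  set c : ℝ := ((L : ℝ) ^ d)⁻¹ with hc
  have hc0 : 0 ≤ c := by positivity
  set I : Finset ((Fin d → Fin L) × ℕ) := (Finset.univ : Finset (Fin d → Fin L)) ×ˢ Finset.range L with hI
  set g : (Fin d → Fin L) × ℕ → ℝ := fun p => ‖X (q + boxVec L p.1 + (p.2 : ℤ) • e κ) κ‖ with hg
  have h1 : ‖(L : ℝ) • Q0cov L V X q κ‖ ≤ ∑ p ∈ I, c * g p := by
    rw [hI, Finset.sum_product]
    exact norm_smul_Q0cov_le L hL V hV X q κ
  have hcard : (#I : ℝ) = (L : ℝ) ^ d * L := by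
    rw [hI, Finset.card_product, Finset.card_univ, Fintype.card_fun, Fintype.card_fin, Fintype.card_fin, Finset.card_range]
    push_cast; ring
  have hLd : (L : ℝ) ^ d * c = 1 := by
    rw [hc]; exact mul_inv_cancel₀ (pow_ne_zero _ (by exact_mod_cast (show L ≠ 0 by omega)))
  have h0 : 0 ≤ ∑ p ∈ I, c * g p := Finset.sum_nonneg fun p _ => mul_nonneg hc0 (norm_nonneg _)
  calc ‖(L : ℝ) • Q0cov L V X q κ‖ ^ 2 ≤ (∑ p ∈ I, c * g p) ^ 2 := pow_le_pow_left₀ (norm_nonneg _) h1 2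
    _ ≤ #I * ∑ p ∈ I, (c * g p) ^ 2 := sq_sum_le_card_mul_sum_sq
    _ = ((L : ℝ) ^ d * c) * ((L : ℝ) * c) * ∑ p ∈ I, g p ^ 2 := by
        rw [hcard]; simp only [mul_pow, ← Finset.mul_sum]; ring
    _ = (L : ℝ) * c * ∑ r : Fin d → Fin L, ∑ t ∈ Finset.range L, ‖X (q + boxVec L r + (t : ℤ) • e κ) κ‖ ^ 2 := by
        rw [hLd, one_mul, hI, Finset.sum_product]

/-- ★★ **THE COVARIANT CELL JENSEN, ONE DIRECTION**: for an `N′L`-periodic `X`,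
`Σ_{z ∈ [0,N′)ᵈ} ‖L·(Q₀X)(L•z,κ)‖² ≤ L²L⁻ᵈ·Σ_{t′ ∈ [0,N′L)ᵈ} ‖X(t′,κ)‖²` — pointwise Jensen, then the shifted blocks cover the fine cell `L` times (✓`Prop7CellBoxMultiplicity.sum_cell_block_seg_eq`):
the A-slot contraction `ρ² = L²L⁻ᵈ`. [cite: Balaban1985Averaging, (2) p.17, (125) p.36] [cite: Balaban1984PropagatorsI, (1.18)-(1.20) pp.19-20] -/
theorem sum_cell_normSq_smul_Q0cov_le (L N' : ℕ) (hL : 1 ≤ L) [NeZero N'] (V : Site d → Fin d → 𝔸ˣ) (hV : ∀ x μ, V x μ ∈ unitaryUnits 𝔸)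
    (X : Site d → Fin d → 𝔸) (hX : ∀ (x : Site d) (κ μ : Fin d), X (x + ((N' * L : ℕ) : ℤ) • e κ) μ = X x μ) (κ : Fin d) :
    ∑ z : Fin d → Fin N', ‖(L : ℝ) • Q0cov L V X ((L : ℤ) • boxVec N' z) κ‖ ^ 2
      ≤ (L : ℝ) ^ 2 * ((L : ℝ) ^ d)⁻¹ * ∑ t' : Fin d → Fin (N' * L), ‖X (boxVec (N' * L) t') κ‖ ^ 2 := by
  set c : ℝ := ((L : ℝ) ^ d)⁻¹ with hc
  -- the shifted blocks `L•z + r + t•e_κ`, `t < L`, cover the fine cell `L` times (F-6d-1)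
  have hcov := sum_cell_block_seg_eq N' L hL (N' * L) rfl (fun y => ‖X y κ‖ ^ 2) (fun y ν => by simp only [hX]) κ
  calc ∑ z : Fin d → Fin N', ‖(L : ℝ) • Q0cov L V X ((L : ℤ) • boxVec N' z) κ‖ ^ 2
      ≤ ∑ z : Fin d → Fin N', (L : ℝ) * c * ∑ r : Fin d → Fin L, ∑ t ∈ Finset.range L,
          ‖X ((L : ℤ) • boxVec N' z + boxVec L r + (t : ℤ) • e κ) κ‖ ^ 2 :=
        Finset.sum_le_sum fun z _ => normSq_smul_Q0cov_le L hL V hV X _ κ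
    _ = (L : ℝ) * c * (L • ∑ t' : Fin d → Fin (N' * L), ‖X (boxVec (N' * L) t') κ‖ ^ 2) := by
        rw [← Finset.mul_sum, hcov]
    _ = (L : ℝ) ^ 2 * c * ∑ t' : Fin d → Fin (N' * L), ‖X (boxVec (N' * L) t') κ‖ ^ 2 := by
        rw [nsmul_eq_mul]; ring

/-- ★★ **THE COVARIANT CELL JENSEN, ALL DIRECTIONS**: for an `N′L`-periodic `X`, `Σ_{z,κ} ‖L·(Q₀X)(L•z,κ)‖² ≤ L²L⁻ᵈ·Σ_{t′,ν} ‖X(t′,ν)‖²`.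
[cite: Balaban1985Averaging, (2) p.17, (125) p.36] [cite: Balaban1984PropagatorsI, (1.18)-(1.20) pp.19-20] -/
theorem sum_cell_dir_normSq_smul_Q0cov_le (L N' : ℕ) (hL : 1 ≤ L) [NeZero N'] (V : Site d → Fin d → 𝔸ˣ) (hV : ∀ x μ, V x μ ∈ unitaryUnits 𝔸)
    (X : Site d → Fin d → 𝔸) (hX : ∀ (x : Site d) (κ μ : Fin d), X (x + ((N' * L : ℕ) : ℤ) • e κ) μ = X x μ) :
    ∑ z : Fin d → Fin N', ∑ κ : Fin d, ‖(L : ℝ) • Q0cov L V X ((L : ℤ) • boxVec N' z) κ‖ ^ 2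
      ≤ (L : ℝ) ^ 2 * ((L : ℝ) ^ d)⁻¹ * ∑ t' : Fin d → Fin (N' * L), ∑ ν : Fin d, ‖X (boxVec (N' * L) t') ν‖ ^ 2 := by
  calc ∑ z : Fin d → Fin N', ∑ κ : Fin d, ‖(L : ℝ) • Q0cov L V X ((L : ℤ) • boxVec N' z) κ‖ ^ 2
      = ∑ κ : Fin d, ∑ z : Fin d → Fin N', ‖(L : ℝ) • Q0cov L V X ((L : ℤ) • boxVec N' z) κ‖ ^ 2 := Finset.sum_comm
    _ ≤ ∑ κ : Fin d, (L : ℝ) ^ 2 * ((L : ℝ) ^ d)⁻¹ * ∑ t' : Fin d → Fin (N' * L), ‖X (boxVec (N' * L) t') κ‖ ^ 2 :=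
        Finset.sum_le_sum fun κ _ => sum_cell_normSq_smul_Q0cov_le L N' hL V hV X hX κ
    _ = (L : ℝ) ^ 2 * ((L : ℝ) ^ d)⁻¹ * ∑ t' : Fin d → Fin (N' * L), ∑ ν : Fin d, ‖X (boxVec (N' * L) t') ν‖ ^ 2 := by
        rw [← Finset.mul_sum, Finset.sum_comm]

end Jensen

/-! ## §3 (iii) The second-order source in two-block `ℓ²`, with the two-block sup as a window letter -/

section Source

variable {d : ℕ} {𝔸 : Type*} [SeminormedAddCommGroup 𝔸]

/-- ★★ **THE SOURCE OVER THE CELL**: if `‖rem(z,κ)‖ ≤ C·((2d+2)L)²·M₂(L•z,κ)` (`M₂` the two-block mass of an `N′L`-periodic field `Y`; ✓`norm_rem2_succ_sub_trueStep_le_twoBlock`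
has `C = 260`) and the two-block WINDOW `(2d+2)L·√M₂(L•z,κ) ≤ μ` holds at every coarse bond of the cell, then `Σ_{z,κ}‖rem(z,κ)‖² ≤ (Cμ)²·((2d+2)L)²·2d·Σ_{t′,ν}‖Y(t′,ν)‖²`
(pointwise `C·x² ≤ C·μ·x` for `x = (2d+2)L√M₂ ≤ μ`, then §1 ✓`sum_cell_twoBlock_eq`). [cite: Balaban1985Averaging, (42) p.23, Prop. 3 (122)-(126) p.36; Balaban1987RG1, (0.4) p.253] -/
theorem sum_cell_normSq_source_le (L N' : ℕ) (hL : 1 ≤ L) [NeZero N'] (R Y : Site d → Fin d → 𝔸)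
    (hY : ∀ (x : Site d) (κ μ : Fin d), Y (x + ((N' * L : ℕ) : ℤ) • e κ) μ = Y x μ) {C μ : ℝ} (hC : 0 ≤ C)
    (hR : ∀ (z : Fin d → Fin N') (κ : Fin d), ‖R (boxVec N' z) κ‖ ≤ C * (((2 * d + 2) * L) ^ 2 * ∑ s : Fin d → Fin L, ∑ ν : Fin d,
      (‖Y ((L : ℤ) • boxVec N' z + boxVec L s) ν‖ ^ 2 + ‖Y ((L : ℤ) • boxVec N' z + (L : ℤ) • e κ + boxVec L s) ν‖ ^ 2)))
    (hμ : ∀ (z : Fin d → Fin N') (κ : Fin d), (2 * d + 2) * L * Real.sqrt (∑ s : Fin d → Fin L, ∑ ν : Fin d,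
      (‖Y ((L : ℤ) • boxVec N' z + boxVec L s) ν‖ ^ 2 + ‖Y ((L : ℤ) • boxVec N' z + (L : ℤ) • e κ + boxVec L s) ν‖ ^ 2)) ≤ μ) :
    ∑ z : Fin d → Fin N', ∑ κ : Fin d, ‖R (boxVec N' z) κ‖ ^ 2
      ≤ (C * μ) ^ 2 * (((2 * d + 2) * L) ^ 2 * (2 * d * ∑ t' : Fin d → Fin (N' * L), ∑ ν : Fin d, ‖Y (boxVec (N' * L) t') ν‖ ^ 2)) := by
  -- the two-block masses
  set M₂ : (Fin d → Fin N') → Fin d → ℝ := fun z κ => ∑ s : Fin d → Fin L, ∑ ν : Fin d,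
    (‖Y ((L : ℤ) • boxVec N' z + boxVec L s) ν‖ ^ 2 + ‖Y ((L : ℤ) • boxVec N' z + (L : ℤ) • e κ + boxVec L s) ν‖ ^ 2) with hM₂
  have hM0 : ∀ z κ, 0 ≤ M₂ z κ := fun z κ => by positivity
  -- pointwise: `‖R‖² ≤ (Cμ)²·((2d+2)L)²·M₂`
  have hpt : ∀ (z : Fin d → Fin N') (κ : Fin d), ‖R (boxVec N' z) κ‖ ^ 2 ≤ (C * μ) ^ 2 * (((2 * d + 2) * L) ^ 2 * M₂ z κ) := by
    intro z κ
    set x : ℝ := (2 * d + 2) * L * Real.sqrt (M₂ z κ) with hx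
    have hx0 : 0 ≤ x := by positivity
    have hxμ : x ≤ μ := hμ z κ
    have hx2 : x ^ 2 = ((2 * d + 2) * L) ^ 2 * M₂ z κ := by rw [hx, mul_pow, Real.sq_sqrt (hM0 z κ)]
    have h1 : ‖R (boxVec N' z) κ‖ ≤ C * μ * x := by
      calc ‖R (boxVec N' z) κ‖ ≤ C * x ^ 2 := by rw [hx2]; exact hR z κ
        _ = C * x * x := by ring
        _ ≤ C * μ * x := mul_le_mul_of_nonneg_right (mul_le_mul_of_nonneg_left hxμ hC) hx0
    calc ‖R (boxVec N' z) κ‖ ^ 2 ≤ (C * μ * x) ^ 2 := pow_le_pow_left₀ (norm_nonneg _) h1 2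
      _ = (C * μ) ^ 2 * (((2 * d + 2) * L) ^ 2 * M₂ z κ) := by rw [← hx2]; ring
  calc ∑ z : Fin d → Fin N', ∑ κ : Fin d, ‖R (boxVec N' z) κ‖ ^ 2
      ≤ ∑ z : Fin d → Fin N', ∑ κ : Fin d, (C * μ) ^ 2 * (((2 * d + 2) * L) ^ 2 * M₂ z κ) :=
        Finset.sum_le_sum fun z _ => Finset.sum_le_sum fun κ _ => hpt z κ
    _ = (C * μ) ^ 2 * (((2 * d + 2) * L) ^ 2 * ∑ z : Fin d → Fin N', ∑ κ : Fin d, M₂ z κ) := by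
        simp only [Finset.mul_sum]
    _ = (C * μ) ^ 2 * (((2 * d + 2) * L) ^ 2 * (2 * d * ∑ t' : Fin d → Fin (N' * L), ∑ ν : Fin d, ‖Y (boxVec (N' * L) t') ν‖ ^ 2)) := by
        rw [hM₂, sum_cell_twoBlock_eq L N' hL Y hY]

end Source

/-! ## §4 ★★★ The mass row: Minkowski over the cell -/

section Row

variable {d : ℕ} {𝔸 : Type*} [CStarAlgebra 𝔸] [Nontrivial 𝔸]

omit [CStarAlgebra 𝔸] [Nontrivial 𝔸] in
/-- **MINKOWSKI IN `ℓ²(s)`** (Cauchy–Schwarz); private copy of `NE3EnergyHessContTwoTerm.sqrt_sum_sq_add_le` (BalabanUV support, not imported across sub-summits). [folklore] -/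
private theorem sqrt_sum_sq_add_le' {ι : Type*} (s : Finset ι) (a b : ι → ℝ) :
    Real.sqrt (∑ i ∈ s, (a i + b i) ^ 2) ≤ Real.sqrt (∑ i ∈ s, a i ^ 2) + Real.sqrt (∑ i ∈ s, b i ^ 2) := by
  set A : ℝ := ∑ i ∈ s, a i ^ 2 with hA
  set B : ℝ := ∑ i ∈ s, b i ^ 2 with hB
  have hA0 : 0 ≤ A := Finset.sum_nonneg fun i _ => sq_nonneg _
  have hB0 : 0 ≤ B := Finset.sum_nonneg fun i _ => sq_nonneg _
  have hcs' : ∑ i ∈ s, a i * b i ≤ Real.sqrt A * Real.sqrt B := by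
    rw [← Real.sqrt_mul hA0]
    exact (le_abs_self _).trans (Real.abs_le_sqrt (Finset.sum_mul_sq_le_sq_mul_sq s a b))
  have hexp : ∑ i ∈ s, (a i + b i) ^ 2 = A + 2 * ∑ i ∈ s, a i * b i + B := by
    rw [hA, hB, Finset.mul_sum, ← Finset.sum_add_distrib, ← Finset.sum_add_distrib]
    exact Finset.sum_congr rfl fun i _ => by ring
  have hrhs0 : 0 ≤ Real.sqrt A + Real.sqrt B := add_nonneg (Real.sqrt_nonneg _) (Real.sqrt_nonneg _)
  rw [← Real.sqrt_sq hrhs0]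
  refine Real.sqrt_le_sqrt ?_
  rw [hexp, add_sq, Real.sq_sqrt hA0, Real.sq_sqrt hB0]
  nlinarith [hcs']

omit [CStarAlgebra 𝔸] [Nontrivial 𝔸] in
/-- **MINKOWSKI, THREE PIECES**: a family in a seminormed group dominated pointwise by three real families, `‖F i‖ ≤ a i + b i + c i` on `s`, has
`√Σ‖F i‖² ≤ √Σa² + √Σb² + √Σc²`. [folklore] -/
theorem sqrt_sum_normSq_le_of_le_add₃ {ι E : Type*} [SeminormedAddCommGroup E] (s : Finset ι) (F : ι → E) (a b c : ι → ℝ)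
    (h : ∀ i ∈ s, ‖F i‖ ≤ a i + b i + c i) :
    Real.sqrt (∑ i ∈ s, ‖F i‖ ^ 2) ≤ Real.sqrt (∑ i ∈ s, a i ^ 2) + Real.sqrt (∑ i ∈ s, b i ^ 2) + Real.sqrt (∑ i ∈ s, c i ^ 2) := by
  calc Real.sqrt (∑ i ∈ s, ‖F i‖ ^ 2) ≤ Real.sqrt (∑ i ∈ s, ((a i + b i) + c i) ^ 2) :=
        Real.sqrt_le_sqrt (Finset.sum_le_sum fun i hi => pow_le_pow_left₀ (norm_nonneg _)
          ((h i hi).trans_eq (by ring)) 2)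
    _ ≤ Real.sqrt (∑ i ∈ s, (a i + b i) ^ 2) + Real.sqrt (∑ i ∈ s, c i ^ 2) := sqrt_sum_sq_add_le' s (fun i => a i + b i) c
    _ ≤ Real.sqrt (∑ i ∈ s, a i ^ 2) + Real.sqrt (∑ i ∈ s, b i ^ 2) + Real.sqrt (∑ i ∈ s, c i ^ 2) :=
        add_le_add (sqrt_sum_sq_add_le' s a b) le_rfl

omit [CStarAlgebra 𝔸] [Nontrivial 𝔸] in
/-- **SCALAR JENSEN WITH A CONSTANT WEIGHT**: `(Σ_{p∈I} c·g p)² ≤ (#I·c²)·Σ_{p∈I} (g p)²` (`sq_sum_le_card_mul_sum_sq`). [folklore] -/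
theorem sq_sum_const_mul_le {β : Type*} (I : Finset β) (c : ℝ) (g : β → ℝ) :
    (∑ p ∈ I, c * g p) ^ 2 ≤ (#I * c ^ 2) * ∑ p ∈ I, g p ^ 2 := by
  calc (∑ p ∈ I, c * g p) ^ 2 ≤ #I * ∑ p ∈ I, (c * g p) ^ 2 := sq_sum_le_card_mul_sum_sq
    _ = (#I * c ^ 2) * ∑ p ∈ I, g p ^ 2 := by simp only [mul_pow, ← Finset.mul_sum]; ring

/-- ★★★ **THE PER-LEVEL `ℓ²` MASS ROW OF THE SOURCED COMB TOWER (MINKOWSKI OVER ONE PERIOD CELL).**  `𝔸` a non-trivial C⋆-algebra; `V` unitary-valued on `ℤᵈ` with every block loop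
of every coarse bond `(L•z, κ)` of the cell within `α ≤ 1∕24` of `1`; `X` (the level-k reduced field `G̃_k`) and `Y` (the source's driving field `Ỹ_k`) `N′L`-periodic; the source
`rem` with `‖rem(z,κ)‖ ≤ C·((2d+2)L)²·M₂[Y](L•z,κ)` and the two-block window `(2d+2)L·√M₂[Y](L•z,κ) ≤ μ` on the cell.  Then ANY coarse family `X′` which on the cell is the sourced
one-step image `X′(z,κ) = T_V(X)(L•z,κ) − (F̂_V X(L•z) − Ad_{V̄(L•z,κ)} F̂_V X(L•z + Le_κ)) + rem(z,κ)` (F-7a's recursion with the (II) choice `CM := F̂` at the corner) obeys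
`√Σ_{z,κ}‖X′(z,κ)‖² ≤ (√(L²L⁻ᵈ) + 210·(2d+2)L·α·√(2d))·√Σ_{t′,ν}‖X(t′,ν)‖² + C·μ·(2d+2)L·√(2d)·√Σ_{t′,ν}‖Y(t′,ν)‖²`
— (i) §2 + (ii) ✓`sum_cell_trueStep_defect_sq_le` (F-5c) + (iii) §3, knitted by Minkowski; the row `m_{k+1} ≤ (ρ + κ_k)·m_k + κ′_k·m̃_k` F-7c iterates.
«(O2) groundwork — not consumed by any displayed row before the freeze lifts.»
[cite: Balaban1985Averaging, (2) p.17, (42)-(43) pp.23-24, Prop. 3 (122)-(126) p.36] [cite: Balaban1984PropagatorsI, (1.18)-(1.20) pp.19-20] [cite: Balaban1987RG1, (0.4) p.253] -/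
theorem sqrt_sum_cell_normSq_step_le (L N' : ℕ) (hL : 1 ≤ L) [NeZero N'] (V : Site d → Fin d → 𝔸ˣ) (hV : ∀ x μ, V x μ ∈ unitaryUnits 𝔸)
    (X X' R Y : Site d → Fin d → 𝔸)
    (hX : ∀ (x : Site d) (κ μ : Fin d), X (x + ((N' * L : ℕ) : ℤ) • e κ) μ = X x μ)
    (hY : ∀ (x : Site d) (κ μ : Fin d), Y (x + ((N' * L : ℕ) : ℤ) • e κ) μ = Y x μ)
    {α : ℝ} (hα0 : 0 ≤ α) (hα24 : α ≤ 1 / 24)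
    (hα : ∀ (z : Fin d → Fin N') (κ : Fin d) (r : Fin d → Fin L), ‖((Wcx L V ((L : ℤ) • boxVec N' z) κ (boxVec L r) : 𝔸ˣ) : 𝔸) - 1‖ ≤ α)
    {C μ : ℝ} (hC : 0 ≤ C) (hμ0 : 0 ≤ μ)
    (hR : ∀ (z : Fin d → Fin N') (κ : Fin d), ‖R (boxVec N' z) κ‖ ≤ C * (((2 * d + 2) * L) ^ 2 * ∑ s : Fin d → Fin L, ∑ ν : Fin d,
      (‖Y ((L : ℤ) • boxVec N' z + boxVec L s) ν‖ ^ 2 + ‖Y ((L : ℤ) • boxVec N' z + (L : ℤ) • e κ + boxVec L s) ν‖ ^ 2)))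
    (hμ : ∀ (z : Fin d → Fin N') (κ : Fin d), (2 * d + 2) * L * Real.sqrt (∑ s : Fin d → Fin L, ∑ ν : Fin d,
      (‖Y ((L : ℤ) • boxVec N' z + boxVec L s) ν‖ ^ 2 + ‖Y ((L : ℤ) • boxVec N' z + (L : ℤ) • e κ + boxVec L s) ν‖ ^ 2)) ≤ μ)
    (hX' : ∀ (z : Fin d → Fin N') (κ : Fin d), X' (boxVec N' z) κ
      = fderiv ℂ (eml : ((Fin d → Fin L) → 𝔸) → 𝔸) (fun r => ((Wcx L V ((L : ℤ) • boxVec N' z) κ (boxVec L r) : 𝔸ˣ) : 𝔸))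
            (fun r => tsum V X ((L : ℤ) • boxVec N' z) (gammaWord L κ (boxVec L r) ++ seg κ (-(L : ℤ))) * ((Wcx L V ((L : ℤ) • boxVec N' z) κ (boxVec L r) : 𝔸ˣ) : 𝔸))
            * (((expUnit (Xavg L V ((L : ℤ) • boxVec N' z) κ))⁻¹ : 𝔸ˣ) : 𝔸)
          + ((expUnit (Xavg L V ((L : ℤ) • boxVec N' z) κ) : 𝔸ˣ) : 𝔸) * tsum V X ((L : ℤ) • boxVec N' z) (seg κ (L : ℤ))
            * (((expUnit (Xavg L V ((L : ℤ) • boxVec N' z) κ))⁻¹ : 𝔸ˣ) : 𝔸)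
        - (FhatCov L V X ((L : ℤ) • boxVec N' z) - conjR (bavg L V ((L : ℤ) • boxVec N' z) κ) (FhatCov L V X ((L : ℤ) • boxVec N' z + (L : ℤ) • e κ)))
        + R (boxVec N' z) κ) :
    Real.sqrt (∑ z : Fin d → Fin N', ∑ κ : Fin d, ‖X' (boxVec N' z) κ‖ ^ 2)
      ≤ (Real.sqrt ((L : ℝ) ^ 2 * ((L : ℝ) ^ d)⁻¹) + 210 * ((2 * d + 2) * L) * α * Real.sqrt (2 * d))
          * Real.sqrt (∑ t' : Fin d → Fin (N' * L), ∑ ν : Fin d, ‖X (boxVec (N' * L) t') ν‖ ^ 2)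
        + C * μ * ((2 * d + 2) * L) * Real.sqrt (2 * d)
          * Real.sqrt (∑ t' : Fin d → Fin (N' * L), ∑ ν : Fin d, ‖Y (boxVec (N' * L) t') ν‖ ^ 2) := by
  classical
  -- letters: the three pieces at the coarse bond `(z, κ)`
  set S : (Fin d → Fin N') × Fin d → 𝔸 := fun p => (L : ℝ) • Q0cov L V X ((L : ℤ) • boxVec N' p.1) p.2 with hS
  set D : (Fin d → Fin N') × Fin d → 𝔸 := fun p =>
    fderiv ℂ (eml : ((Fin d → Fin L) → 𝔸) → 𝔸) (fun r => ((Wcx L V ((L : ℤ) • boxVec N' p.1) p.2 (boxVec L r) : 𝔸ˣ) : 𝔸))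
          (fun r => tsum V X ((L : ℤ) • boxVec N' p.1) (gammaWord L p.2 (boxVec L r) ++ seg p.2 (-(L : ℤ))) * ((Wcx L V ((L : ℤ) • boxVec N' p.1) p.2 (boxVec L r) : 𝔸ˣ) : 𝔸))
          * (((expUnit (Xavg L V ((L : ℤ) • boxVec N' p.1) p.2))⁻¹ : 𝔸ˣ) : 𝔸)
        + ((expUnit (Xavg L V ((L : ℤ) • boxVec N' p.1) p.2) : 𝔸ˣ) : 𝔸) * tsum V X ((L : ℤ) • boxVec N' p.1) (seg p.2 (L : ℤ))
          * (((expUnit (Xavg L V ((L : ℤ) • boxVec N' p.1) p.2))⁻¹ : 𝔸ˣ) : 𝔸)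
      - (FhatCov L V X ((L : ℤ) • boxVec N' p.1) - conjR (bavg L V ((L : ℤ) • boxVec N' p.1) p.2) (FhatCov L V X ((L : ℤ) • boxVec N' p.1 + (L : ℤ) • e p.2))
          + (L : ℝ) • Q0cov L V X ((L : ℤ) • boxVec N' p.1) p.2) with hD
  set Rp : (Fin d → Fin N') × Fin d → 𝔸 := fun p => R (boxVec N' p.1) p.2 with hRp
  set MX : ℝ := ∑ t' : Fin d → Fin (N' * L), ∑ ν : Fin d, ‖X (boxVec (N' * L) t') ν‖ ^ 2 with hMX
  set MY : ℝ := ∑ t' : Fin d → Fin (N' * L), ∑ ν : Fin d, ‖Y (boxVec (N' * L) t') ν‖ ^ 2 with hMY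
  -- the decomposition `X′ = S + D + R` on the cell
  have hdec : ∀ p : (Fin d → Fin N') × Fin d, X' (boxVec N' p.1) p.2 = S p + D p + Rp p := by
    rintro ⟨z, κ⟩
    simp only [hS, hD, hRp]
    rw [hX' z κ]
    abel
  have hpt : ∀ p ∈ (Finset.univ : Finset ((Fin d → Fin N') × Fin d)), ‖X' (boxVec N' p.1) p.2‖ ≤ ‖S p‖ + ‖D p‖ + ‖Rp p‖ := by
    intro p _
    rw [hdec p]
    exact norm_add₃_le
  -- Minkowski over the cell × directions
  have hMink := sqrt_sum_normSq_le_of_le_add₃ (Finset.univ : Finset ((Fin d → Fin N') × Fin d)) (fun p => X' (boxVec N' p.1) p.2)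
    (fun p => ‖S p‖) (fun p => ‖D p‖) (fun p => ‖Rp p‖) hpt
  simp only [Fintype.sum_prod_type] at hMink
  -- (i) the straight step
  have h1 : Real.sqrt (∑ z : Fin d → Fin N', ∑ κ : Fin d, ‖S (z, κ)‖ ^ 2) ≤ Real.sqrt ((L : ℝ) ^ 2 * ((L : ℝ) ^ d)⁻¹) * Real.sqrt MX := by
    rw [← Real.sqrt_mul (by positivity)]
    exact Real.sqrt_le_sqrt (sum_cell_dir_normSq_smul_Q0cov_le L N' hL V hV X hX)
  -- (ii) the defect (F-5c)
  have h2 : Real.sqrt (∑ z : Fin d → Fin N', ∑ κ : Fin d, ‖D (z, κ)‖ ^ 2) ≤ 210 * ((2 * d + 2) * L) * α * Real.sqrt (2 * d) * Real.sqrt MX := by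
    have hD2 := sum_cell_trueStep_defect_sq_le L N' hL V hV X hX hα hα24
    have e1 : (210 * ((2 * (d : ℝ) + 2) * L)) ^ 2 * α ^ 2 * (2 * d) * MX = (210 * ((2 * d + 2) * L) * α) ^ 2 * ((2 * d) * MX) := by ring
    have hK0 : 0 ≤ 210 * ((2 * (d : ℝ) + 2) * L) * α := by positivity
    calc Real.sqrt (∑ z : Fin d → Fin N', ∑ κ : Fin d, ‖D (z, κ)‖ ^ 2)
        ≤ Real.sqrt ((210 * ((2 * (d : ℝ) + 2) * L)) ^ 2 * α ^ 2 * (2 * d) * MX) := by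
          refine Real.sqrt_le_sqrt ?_
          simp only [hD, hMX]
          exact hD2
      _ = 210 * ((2 * d + 2) * L) * α * Real.sqrt (2 * d) * Real.sqrt MX := by
          rw [e1, Real.sqrt_mul (sq_nonneg _), Real.sqrt_sq hK0, Real.sqrt_mul (by positivity)]
          ring
  -- (iii) the source
  have h3 : Real.sqrt (∑ z : Fin d → Fin N', ∑ κ : Fin d, ‖Rp (z, κ)‖ ^ 2) ≤ C * μ * ((2 * d + 2) * L) * Real.sqrt (2 * d) * Real.sqrt MY := by
    have h := sum_cell_normSq_source_le L N' hL R Y hY hC hR hμ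
    have hK0 : 0 ≤ C * μ * ((2 * (d : ℝ) + 2) * L) := by positivity
    have e1 : (C * μ) ^ 2 * (((2 * (d : ℝ) + 2) * L) ^ 2 * (2 * d * MY)) = (C * μ * ((2 * d + 2) * L)) ^ 2 * ((2 * d) * MY) := by ring
    calc Real.sqrt (∑ z : Fin d → Fin N', ∑ κ : Fin d, ‖Rp (z, κ)‖ ^ 2) ≤ Real.sqrt ((C * μ * ((2 * (d : ℝ) + 2) * L)) ^ 2 * ((2 * d) * MY)) := by
          rw [← e1]; exact Real.sqrt_le_sqrt h
      _ = C * μ * ((2 * d + 2) * L) * Real.sqrt (2 * d) * Real.sqrt MY := by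
          rw [Real.sqrt_mul (sq_nonneg _), Real.sqrt_sq hK0, Real.sqrt_mul (by positivity)]
          ring
  -- knit
  calc Real.sqrt (∑ z : Fin d → Fin N', ∑ κ : Fin d, ‖X' (boxVec N' z) κ‖ ^ 2)
      ≤ Real.sqrt (∑ z : Fin d → Fin N', ∑ κ : Fin d, ‖S (z, κ)‖ ^ 2) + Real.sqrt (∑ z : Fin d → Fin N', ∑ κ : Fin d, ‖D (z, κ)‖ ^ 2)
          + Real.sqrt (∑ z : Fin d → Fin N', ∑ κ : Fin d, ‖Rp (z, κ)‖ ^ 2) := by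
        simpa only [norm_norm] using hMink
    _ ≤ Real.sqrt ((L : ℝ) ^ 2 * ((L : ℝ) ^ d)⁻¹) * Real.sqrt MX + 210 * ((2 * d + 2) * L) * α * Real.sqrt (2 * d) * Real.sqrt MX
          + C * μ * ((2 * d + 2) * L) * Real.sqrt (2 * d) * Real.sqrt MY := add_le_add (add_le_add h1 h2) h3
    _ = _ := by rw [hMX, hMY]; ring

/-- ★★ **THE MASS ROW AT LEVEL `k` OF THE BACKGROUND TOWER**: ✓`sqrt_sum_cell_normSq_step_le` at `V = Ū₀ᵏ = avgIter L U₀ k`, the coarse bond of the recursion written as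
`Ū₀ᵏ⁺¹(z,κ) = avgIter L U₀ (k+1) z κ` (lit ✓`avgIter_succ`: `= bavg L Ū₀ᵏ (L•z) κ`) — the letters of ✓`Prop7CornerCombStructure.cornerComb_structure` ∕ F-7a with
`CM k X z := FhatCov L (avgIter L U₀ k) X (L•z)`. «(O2) groundwork.» [cite: Balaban1985Averaging, (43) p.24, Prop. 3 (122)-(126) p.36] [cite: Balaban1984PropagatorsI, (1.18)-(1.20) pp.19-20] -/
theorem sqrt_sum_cell_normSq_step_le_level (L N' : ℕ) (hL : 1 ≤ L) [NeZero N'] (U₀ : Site d → Fin d → 𝔸ˣ) (k : ℕ)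
    (hV : ∀ x μ, avgIter L U₀ k x μ ∈ unitaryUnits 𝔸) (X X' R Y : Site d → Fin d → 𝔸)
    (hX : ∀ (x : Site d) (κ μ : Fin d), X (x + ((N' * L : ℕ) : ℤ) • e κ) μ = X x μ)
    (hY : ∀ (x : Site d) (κ μ : Fin d), Y (x + ((N' * L : ℕ) : ℤ) • e κ) μ = Y x μ)
    {α : ℝ} (hα0 : 0 ≤ α) (hα24 : α ≤ 1 / 24)
    (hα : ∀ (z : Fin d → Fin N') (κ : Fin d) (r : Fin d → Fin L), ‖((Wcx L (avgIter L U₀ k) ((L : ℤ) • boxVec N' z) κ (boxVec L r) : 𝔸ˣ) : 𝔸) - 1‖ ≤ α)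
    {C μ : ℝ} (hC : 0 ≤ C) (hμ0 : 0 ≤ μ)
    (hR : ∀ (z : Fin d → Fin N') (κ : Fin d), ‖R (boxVec N' z) κ‖ ≤ C * (((2 * d + 2) * L) ^ 2 * ∑ s : Fin d → Fin L, ∑ ν : Fin d,
      (‖Y ((L : ℤ) • boxVec N' z + boxVec L s) ν‖ ^ 2 + ‖Y ((L : ℤ) • boxVec N' z + (L : ℤ) • e κ + boxVec L s) ν‖ ^ 2)))
    (hμ : ∀ (z : Fin d → Fin N') (κ : Fin d), (2 * d + 2) * L * Real.sqrt (∑ s : Fin d → Fin L, ∑ ν : Fin d,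
      (‖Y ((L : ℤ) • boxVec N' z + boxVec L s) ν‖ ^ 2 + ‖Y ((L : ℤ) • boxVec N' z + (L : ℤ) • e κ + boxVec L s) ν‖ ^ 2)) ≤ μ)
    (hX' : ∀ (z : Fin d → Fin N') (κ : Fin d), X' (boxVec N' z) κ
      = fderiv ℂ (eml : ((Fin d → Fin L) → 𝔸) → 𝔸) (fun r => ((Wcx L (avgIter L U₀ k) ((L : ℤ) • boxVec N' z) κ (boxVec L r) : 𝔸ˣ) : 𝔸))
            (fun r => tsum (avgIter L U₀ k) X ((L : ℤ) • boxVec N' z) (gammaWord L κ (boxVec L r) ++ seg κ (-(L : ℤ)))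
              * ((Wcx L (avgIter L U₀ k) ((L : ℤ) • boxVec N' z) κ (boxVec L r) : 𝔸ˣ) : 𝔸))
            * (((expUnit (Xavg L (avgIter L U₀ k) ((L : ℤ) • boxVec N' z) κ))⁻¹ : 𝔸ˣ) : 𝔸)
          + ((expUnit (Xavg L (avgIter L U₀ k) ((L : ℤ) • boxVec N' z) κ) : 𝔸ˣ) : 𝔸) * tsum (avgIter L U₀ k) X ((L : ℤ) • boxVec N' z) (seg κ (L : ℤ))
            * (((expUnit (Xavg L (avgIter L U₀ k) ((L : ℤ) • boxVec N' z) κ))⁻¹ : 𝔸ˣ) : 𝔸)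
        - (FhatCov L (avgIter L U₀ k) X ((L : ℤ) • boxVec N' z)
            - conjR (avgIter L U₀ (k + 1) (boxVec N' z) κ) (FhatCov L (avgIter L U₀ k) X ((L : ℤ) • boxVec N' z + (L : ℤ) • e κ)))
        + R (boxVec N' z) κ) :
    Real.sqrt (∑ z : Fin d → Fin N', ∑ κ : Fin d, ‖X' (boxVec N' z) κ‖ ^ 2)
      ≤ (Real.sqrt ((L : ℝ) ^ 2 * ((L : ℝ) ^ d)⁻¹) + 210 * ((2 * d + 2) * L) * α * Real.sqrt (2 * d))
          * Real.sqrt (∑ t' : Fin d → Fin (N' * L), ∑ ν : Fin d, ‖X (boxVec (N' * L) t') ν‖ ^ 2)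
        + C * μ * ((2 * d + 2) * L) * Real.sqrt (2 * d)
          * Real.sqrt (∑ t' : Fin d → Fin (N' * L), ∑ ν : Fin d, ‖Y (boxVec (N' * L) t') ν‖ ^ 2) := by
  simp only [avgIter_succ, rescale_apply] at hX'
  exact sqrt_sum_cell_normSq_step_le L N' hL (avgIter L U₀ k) hV X X' R Y hX hY hα0 hα24 hα hC hμ0 hR hμ hX'

end Row

end Summit.QuantumFields.YangMills.Theorems.Prop7CornerCombCovMassStep

end
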